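import Literature.IUT.LogThetaLattice.HolomorphicHull

/-!
# [IUTchIII] Remark 3.9.5 (i), (ii): the holomorphic hull as a closure operation — proof companion

S. Mochizuki, *Inter-universal Teichmüller theory III*, kurims manuscript (May 2020), §3, Remark 3.9.5
(i), (ii), kurims pp. 127–128. Proof-only companion of `Literature/IUT/LogThetaLattice/HolomorphicHull.lean`
(no new definitions): the three closure-operator properties of `holomorphicHull` that the text uses
tacitly when it calls the hull map "a sort of canonical splitting of the inclusion `ℋ ⊆ 𝒫`" with
(P1)–(P3) — extensivity (already `subset_holomorphicHull`), MONOTONICITY and IDEMPOTENCE — and the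
fact that hull-sets are their own hulls ((P1)). Requested shape for the Cor. 3.12 crew
(abc-iut-c312-6, STATUS 2026-08-25T18:49:18Z: "`holomorphicHull`/`IsHullSet` … packaged as a Mathlib
`ClosureOperator` (Moore family of hull-sets)"): these lemmas are exactly the fields such a packaging
needs, on the relatively compact sets. Tag form [claim: Mochizuki2012, status: disputed].
-/

namespace Literature.IUT.LogThetaLattice

universe u v

variable {ι : Type u} {k : ι → Type v} [∀ i, Field (k i)] (O : ∀ i, Subring (k i))
  [∀ i, TopologicalSpace (k i)]

/-- For relatively compact `U`, the holomorphic hull is the intersection of the hull-sets containing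
`U` ([IUTchIII] Remark 3.9.5 (i), p. 127 / (ii) "`φ(P) = ⋂_{ℋ ∋ H ⊇ P} H`") — definitional unfolding.
[claim: Mochizuki2012, status: disputed] -/
theorem holomorphicHull_eq_sInter {U : Set (∀ i, k i)} (hU : IsCompact (closure U)) :
    holomorphicHull O U = ⋂₀ {H | IsHullSet O H ∧ U ⊆ H} := by
  unfold holomorphicHull
  rw [if_pos hU]

/-- A hull-set containing `U` contains the hull of `U`, and conversely — the adjunction behind
"the smallest subset of the form `λ · 𝒪` that contains `U`" ([IUTchIII] Remark 3.9.5 (i), p. 127) —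
PROVED for relatively compact `U`. [claim: Mochizuki2012, status: disputed] -/
theorem hullSet_superset_iff {U H : Set (∀ i, k i)} (hU : IsCompact (closure U)) (hH : IsHullSet O H) :
    holomorphicHull O U ⊆ H ↔ U ⊆ H :=
  ⟨fun h => (subset_holomorphicHull O U).trans h, fun h => holomorphicHull_subset O hU hH h⟩

/-- MONOTONICITY of the holomorphic hull ((P3) of [IUTchIII] Remark 3.9.5 (ii), p. 127:
"`φ(P₁) ⊆ φ(P₂)`, for any `P₁, P₂ ∈ 𝒫` such that `P₁ ⊆ P₂`") — PROVED (if `U'` is not relatively compact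
its hull is everything; otherwise `U` is relatively compact too). [claim: Mochizuki2012, status: disputed] -/
theorem holomorphicHull_mono {U U' : Set (∀ i, k i)} (h : U ⊆ U') :
    holomorphicHull O U ⊆ holomorphicHull O U' := by
  by_cases hU' : IsCompact (closure U')
  · have hU : IsCompact (closure U) := hU'.of_isClosed_subset isClosed_closure (closure_mono h)
    rw [holomorphicHull_eq_sInter O hU, holomorphicHull_eq_sInter O hU']
    exact Set.sInter_subset_sInter fun H hH => ⟨hH.1, h.trans hH.2⟩
  · unfold holomorphicHull
    rw [if_neg hU']
    exact Set.subset_univ _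

/-- A hull-set is its own holomorphic hull ((P1) of [IUTchIII] Remark 3.9.5 (ii), p. 127:
"`φ(H) = H`, for any `H ∈ ℋ`") — PROVED for relatively compact hull-sets.
[claim: Mochizuki2012, status: disputed] -/
theorem holomorphicHull_of_isHullSet {H : Set (∀ i, k i)} (hH : IsHullSet O H)
    (hHc : IsCompact (closure H)) : holomorphicHull O H = H :=
  Set.Subset.antisymm (holomorphicHull_subset O hHc hH subset_rfl) (subset_holomorphicHull O H)

/-- IDEMPOTENCE of the holomorphic hull (the hull map takes values in `ℋ` and fixes `ℋ`, [IUTchIII]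
Remark 3.9.5 (ii), p. 127) — PROVED whenever the hull of `U` is itself relatively compact (e.g. when
some hull-set with compact closure contains `U`): the hull-sets containing `U` are exactly those
containing its hull. [claim: Mochizuki2012, status: disputed] -/
theorem holomorphicHull_idem {U : Set (∀ i, k i)} (hU : IsCompact (closure U))
    (hhU : IsCompact (closure (holomorphicHull O U))) :
    holomorphicHull O (holomorphicHull O U) = holomorphicHull O U := by
  apply Set.Subset.antisymm
  · rw [holomorphicHull_eq_sInter O hhU, holomorphicHull_eq_sInter O hU]
    apply Set.sInter_subset_sInter
    rintro H ⟨hH, hUH⟩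
    refine ⟨hH, ?_⟩
    rw [← holomorphicHull_eq_sInter O hU]
    exact holomorphicHull_subset O hU hH hUH
  · exact subset_holomorphicHull O _

/-- If some hull-set with compact closure contains the relatively compact set `U`, then the hull of
`U` is relatively compact (so `holomorphicHull_idem` applies) — PROVED.
[claim: Mochizuki2012, status: disputed] -/
theorem isCompact_closure_holomorphicHull {U H : Set (∀ i, k i)} (hU : IsCompact (closure U))
    (hH : IsHullSet O H) (hUH : U ⊆ H) (hHc : IsCompact (closure H)) :
    IsCompact (closure (holomorphicHull O U)) :=
  hHc.of_isClosed_subset isClosed_closure (closure_mono (holomorphicHull_subset O hU hH hUH))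

/-- The hull map of [IUTchIII] Remark 3.9.5 (ii), p. 127, restricted to the direct product regions
that are contained in some hull-set with compact closure, IS a hull map in the sense of `IsHullMap`
((P1), (P2), (P3) + values in `ℋ`), for `ℋ` := the hull-sets with compact closure and `𝒫` := any family
of relatively compact sets containing `ℋ`, each member of which lies in some member of `ℋ` and whose
hulls are hull-sets (the well-definedness statement `holomorphicHull_isHullSet`) — PROVED from the
lemmas above. [claim: Mochizuki2012, status: disputed] -/
theorem isHullMap_holomorphicHull (Preg : Set (Set (∀ i, k i)))
    (hPc : ∀ P ∈ Preg, IsCompact (closure P))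
    (hPH : ∀ P ∈ Preg, ∃ H, IsHullSet O H ∧ P ⊆ H ∧ IsCompact (closure H))
    (hwd : ∀ P ∈ Preg, IsHullSet O (holomorphicHull O P)) :
    IsHullMap Preg {H | IsHullSet O H ∧ IsCompact (closure H)} (holomorphicHull O) where
  maps P hP := by
    obtain ⟨H, hH, hPH', hHc⟩ := hPH P hP
    exact ⟨hwd P hP, isCompact_closure_holomorphicHull O (hPc P hP) hH hPH' hHc⟩
  P1 H hH := holomorphicHull_of_isHullSet O hH.1 hH.2
  P2 P _ := subset_holomorphicHull O P
  P3 P₁ _ P₂ _ h := holomorphicHull_mono O h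

end Literature.IUT.LogThetaLattice
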